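/-
Fleet lead `ym-wcr-19609-p1` (seat prover-ym-wcr-19609-p1-g2-0), route `WeakCouplingRates`, crux `BulkDominatesColdBoxW`
(stmt-QuantumFields-19609), line `dlr-chessboard` (v8): goodTD sandwich, step 2 — chart coordinates of `cfgTD t` are small when circulations are.
-/
import Summits.QuantumFields.YangMills.Theorems.WeakCouplingRatesBulkDominatesColdBoxWGlueSdatBound
import Summits.QuantumFields.YangMills.Theorems.WeakCouplingRatesColdBoxDatumSplit

/-!
# Crux `BulkDominatesColdBoxW`, expansion stubs: goodTD sandwich, step 2 — the chart coordinates of `cfgTD H β ϑ t` are uniformly small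

The chart coordinates of the datum configuration are `v_e = extDatum ϑ (unscaleT H β (t + meanT H β ϑ)) e`; on the enlarged box
`√(2β)·v_{e,c} = A_c(e)` with `A_c = glue ϑ'_c (mean ϑ'_c + t_c)` (`sqrt_mul_extDatum_unscaleT_eq`, seat ym-wcr-19608-p2), off the cold box `v_e = ϑ(e)`.
Hence, under the hypotheses of step 1 (`abs_glue_sdat_shift_le`: circulations `≤ R`, background `≤ R'`, exterior `≤ r`, forest zero),
`Σ_c v_{e,c}² ≤ r² + 3ρ²/(2β)` for EVERY edge, `ρ = (12H²+2H+1)((R+R') + 4√(2β)r)` (`sum_sq_extDatum_shift_le`).  Step 3 (costs of touching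
plaquettes via `abs_plaqCostAt_gnomonic_sub_sum_sq_le` and `sqrt_mul_sCirc_extDatum_eq`, then `mem_coldGoodSet_iff`) completes the datum twin of
`smallField_subset_goodT`.  No new definition; standard axioms.  NOT a claim about the mass gap.
-/

set_option autoImplicit false

noncomputable section

open Finset
open Literature.Probability.LatticeModels Literature.MathematicalPhysics.QuantumLattice
open Literature.MathematicalPhysics.QuantumFieldTheory Literature.MathematicalPhysics.QuantumFieldTheory.AxialGauge
open Literature.MathematicalPhysics.QuantumFieldTheory.LatticeMaxwell

namespace Summit.QuantumFields.YangMills.Theorems.WeakCouplingRates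

variable {H : ℕ}

/-- **goodTD sandwich, step 2: chart coordinates are small.** -/
theorem sum_sq_extDatum_shift_le {β : ℝ} (hβ : 0 < β) (hH : 1 ≤ H)
    {ϑ : Fin 3 → Literature.MathematicalPhysics.QuantumLattice.ZdEdge 4 → ℝ} {r R R' : ℝ} (hr : 0 ≤ r) (hR : 0 ≤ R) (hR' : 0 ≤ R')
    (hϑ : ∀ e, e ∉ boxEdges 4 (2 * H + 1) → ∑ c, ϑ c e ^ 2 ≤ r ^ 2)
    (hforest : ∀ x : Site 4, (∀ k : Fin 4, 1 ≤ x k ∧ x k + 1 ≤ 2 * (H : ℤ)) → ∀ c, ϑ c (x, 0) = 0)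
    {t : TSpace H}
    (ht : ∀ (c : Fin 3) (p : ZdPlaquette 4), |dirCirc H (p.1, p.2.1.1, p.2.1.2) (t c)| ≤ R)
    (hF : ∀ (c : Fin 3) (p : ZdPlaquette 4), |sCirc (glue (pin := fun e => e ∉ dirFreeEdges H) dirCorner (2 * H + 3) (sdat β ϑ c)
        (mean (fun e => e ∉ dirFreeEdges H) dirCorner (2 * H + 3) (sdat β ϑ c))) (p.1, p.2.1.1, p.2.1.2)| ≤ R')
    (e : Literature.MathematicalPhysics.QuantumLattice.ZdEdge 4) :
    ∑ c, extDatum (fun e c => ϑ c e) (unscaleT H β (t + meanT H β ϑ)) e c ^ 2 ≤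
      r ^ 2 + 3 * ((12 * (H : ℝ) ^ 2 + 2 * H + 1) * ((R + R') + 4 * (Real.sqrt (2 * β) * r))) ^ 2 / (2 * β) := by
  set ρ : ℝ := (12 * (H : ℝ) ^ 2 + 2 * H + 1) * ((R + R') + 4 * (Real.sqrt (2 * β) * r)) with hρ
  have hρ0 : 0 ≤ ρ := by
    rw [hρ]; exact mul_nonneg (by positivity) (by nlinarith [Real.sqrt_nonneg (2 * β)])
  have hsq0 : 0 ≤ 3 * ρ ^ 2 / (2 * β) := by positivity
  have hr2 : 0 ≤ r ^ 2 := sq_nonneg _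
  by_cases hΛ : e ∈ boxEdges 4 (2 * H + 1)
  · -- on the cold box: `√(2β) v = A_c`, `|A_c| ≤ ρ`
    have hE : e ∈ boxEdgesAt dirCorner (2 * H + 3) := boxEdges_subset_boxEdgesAt_dirCorner H hΛ
    have hc : 0 < Real.sqrt (2 * β) := Real.sqrt_pos.2 (by linarith)
    have hcomp : ∀ c, extDatum (fun e c => ϑ c e) (unscaleT H β (t + meanT H β ϑ)) e c ^ 2 ≤ ρ ^ 2 / (2 * β) := by
      intro c
      have hA := abs_glue_sdat_shift_le (β := β) hH hr hR hR' hϑ hforest c (ht c) (hF c) e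
      have hid := sqrt_mul_extDatum_unscaleT_eq (H := H) hβ ϑ hforest (t + meanT H β ϑ) c hE
      have hs : WithLp.ofLp ((t + meanT H β ϑ) c) =
          mean (fun e => e ∉ dirFreeEdges H) dirCorner (2 * H + 3) (sdat β ϑ c) + WithLp.ofLp (t c) := by
        rw [Pi.add_apply, WithLp.ofLp_add, meanT_apply, add_comm]
      rw [hs] at hid
      -- `|√(2β) v| ≤ ρ`
      have hv : |Real.sqrt (2 * β) * extDatum (fun e c => ϑ c e) (unscaleT H β (t + meanT H β ϑ)) e c| ≤ ρ := by rw [hid]; exact hA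
      rw [abs_mul, abs_of_pos hc] at hv
      have h2β : Real.sqrt (2 * β) ^ 2 = 2 * β := Real.sq_sqrt (by linarith)
      rw [le_div_iff₀ (by linarith : (0 : ℝ) < 2 * β), ← h2β, ← mul_pow]
      have hvabs : |extDatum (fun e c => ϑ c e) (unscaleT H β (t + meanT H β ϑ)) e c * Real.sqrt (2 * β)| ≤ ρ := by
        rw [mul_comm]; rw [abs_mul, abs_of_pos hc]; exact hv
      have := pow_le_pow_left₀ (abs_nonneg _) hvabs 2
      rwa [sq_abs] at this
    calc ∑ c, extDatum (fun e c => ϑ c e) (unscaleT H β (t + meanT H β ϑ)) e c ^ 2 ≤ ∑ _c : Fin 3, ρ ^ 2 / (2 * β) :=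
          Finset.sum_le_sum fun c _ => hcomp c
      _ = 3 * ρ ^ 2 / (2 * β) := by rw [Finset.sum_const, Finset.card_univ, Fintype.card_fin, nsmul_eq_mul]; ring
      _ ≤ r ^ 2 + 3 * ρ ^ 2 / (2 * β) := by linarith
  · -- off the cold box: `v = ϑ`
    have hx : ∀ c, extDatum (fun e c => ϑ c e) (unscaleT H β (t + meanT H β ϑ)) e c = ϑ c e := fun c => by
      rw [extDatum_of_not_mem _ _ hΛ]
    simp_rw [hx]
    exact (hϑ e hΛ).trans (by linarith)

end Summit.QuantumFields.YangMills.Theorems.WeakCouplingRates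

end
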